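import Mathlib
import Summits.NavierStokesRegularity.NavierStokesRegularity.Theorems.EulerZoomLiouvillePowerGaugeEulerLiouvilleFatCoreDefs
import Summits.NavierStokesRegularity.NavierStokesRegularity.Theorems.EulerZoomLiouvillePowerGaugeEulerLiouvilleHoopRunDefs
import Summits.NavierStokesRegularity.NavierStokesRegularity.Theorems.EulerZoomLiouvillePowerGaugeEulerLiouvilleHoopRunBareDefs
import Summits.NavierStokesRegularity.NavierStokesRegularity.Theorems.EulerZoomLiouvillePowerGaugeEulerLiouvilleHoopRunFreeDefs
import Summits.NavierStokesRegularity.NavierStokesRegularity.Theorems.EulerZoomLiouvillePowerGaugeEulerLiouvilleMomentFloorGlue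
import Summits.NavierStokesRegularity.NavierStokesRegularity.Theorems.EulerZoomLiouvillePowerGaugeEulerLiouvilleNeedleBandLaw
import Literature.Analysis.FluidPDE.SuitableWeak
import Literature.Analysis.FluidPDE.WeakSolution
import Literature.Analysis.FluidPDE.ClassicalSolution
import Literature.Analysis.FluidPDE.Vorticity
import Literature.Analysis.FluidPDE.AxisymmetricEuler
import Literature.Analysis.FluidPDE.AxisymHouLiVariables
import Literature.Analysis.FluidPDE.SelfSimilarEulerProfile
import Literature.Analysis.FluidPDE.SelfSimilarCollapseAnsatz
import Literature.Analysis.FluidPDE.TaoEnstrophyLocalisation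
import Literature.Analysis.FunctionSpaces.SobolevDomain
import Literature.Analysis.ODE.EvolutionMap
import HarnessLib

/-!
# Crux `EulerZoomLiouville.PowerGaugeEulerLiouville` (stmt-NavierStokesRegularity-19832): the binder predicates of the
# LEAD skeleton, part 1 of 3 (`E3`, `InClass` … `HasResidenceClock`)

Route №10 `EulerZoomLiouville` (NavierStokesRegularity), crux E.  D-0017 `<RouteSlug>Defs`: the objects the route POSITS — here the
52 `@[reducible]` binder predicates (killed strata) of the LEAD-of-record skeleton `Cruxes/PowerGaugeEulerLiouville/Lines/birth.lean`
v115 (ns-typeII-p2 g16, commit 97807a79e132), lines 134–924, moved VERBATIM (texts and docstrings byte-identical; only the namespace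
prefix changes from `…Cruxes.PowerGaugeEulerLiouville.Birth` to `…Theorems.PowerGaugeEulerLiouville.Birth`) so that the skeleton (v117+)
and the ideators' line files can `import` them instead of carrying 80 kB of copies (LEAD key W2-DEFS, ns-ezl-w1 g10's offer (iv),
executor ns-ezl-w2 g8).  Split into three files by the 400-line cap: this file (l.134–402), `…BirthDefsTwo` (l.403–627),
`…BirthDefsThree` (l.628–924); import `…BirthDefsThree` to get all 52.  Credits / senses of every predicate: the LEAD's
`CENSUS-19832-vNN.md` files (evidence on the crux item).  No Cruxes or Theses module is imported.

WHAT THIS IS NOT: not NS, not E — DEFINITIONS ONLY (no theorem); nothing is claimed about the strata here; the crux 19832 stays OPEN.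
-/

noncomputable section

open MeasureTheory Set Filter Topology Metric
open scoped ENNReal NNReal ContDiff

-- flat `Theorems/<Route><Decl>…` files of one crux share the namespace of the crux (tree convention)
set_option linter.dupNamespace false

namespace Summit.NavierStokesRegularity.NavierStokesRegularity.Theorems.PowerGaugeEulerLiouville.Birth

/-- Local abbreviation: ℝ³. -/
abbrev E3 : Type := EuclideanSpace ℝ (Fin 3)

/-- `(u,p,H)` is an ancient local-energy Euler flow on `ℝ³ × (−∞,0)` in Seregin's power-gauged class with exponent
`ρ` and constant `c` — verbatim the three hypotheses of the crux. -/
@[reducible] def InClass (ρ : ℝ) (u : ℝ → E3 → E3) (p : ℝ → E3 → ℝ) (H : ℝ → E3 → E3 →L[ℝ] E3)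
    (c : ℝ≥0) : Prop :=
  Literature.Analysis.FluidPDE.IsSuitableWeakSolutionOn
      (Literature.Analysis.FluidPDE.slab (EuclideanSpace ℝ (Fin 3)) (Set.Iio 0) isOpen_Iio) 0 0 u p ∧
    Literature.Analysis.FluidPDE.HasWeakSpatialGradientOn
      (Literature.Analysis.FluidPDE.slab (EuclideanSpace ℝ (Fin 3)) (Set.Iio 0) isOpen_Iio) u H ∧
    (∀ a : ℝ, 0 < a →
      ENNReal.ofReal (a ^ (2 * ρ)) * Literature.Analysis.FluidPDE.cknA a (0 : ℝ × E3) u +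
          ENNReal.ofReal (a ^ ρ) * Literature.Analysis.FluidPDE.cknE a (0 : ℝ × E3) H +
        ENNReal.ofReal (a ^ (2 * ρ)) * Literature.Analysis.FluidPDE.cknD a (0 : ℝ × E3) p ≤ (c : ℝ≥0∞))

/-- Energy-quiescent past: for every `ε > 0` and every `N`, the set of times `s < −N` at which the total energy
`∫_{ℝ³}|u(s)|²` is at most `ε` has positive measure. -/
@[reducible] def QuiescentPast (u : ℝ → E3 → E3) : Prop :=
  ∀ ε : ℝ, 0 < ε → ∀ N : ℝ, volume {s : ℝ | s < -N ∧ ∫⁻ x, ‖u s x‖ₑ ^ 2 ≤ ENNReal.ofReal ε} ≠ 0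

/-- STEADY-TYPE PAST on a sub-slab `(−∞, T₁)`, `T₁ ≤ 0`, ten killed senses — senses/credits: CENSUS-19832-vNN.md. -/
@[reducible] def IsPastSteady (ρ : ℝ) (u : ℝ → E3 → E3) : Prop :=
  (∃ T₁ : ℝ, T₁ ≤ 0 ∧ ∃ v : E3 → E3, ∀ τ : ℝ, τ < T₁ → u τ = v) ∨
  (∃ T₁ P : ℝ, ∃ d w : E3, T₁ ≤ 0 ∧ 0 < P ∧ ∀ τ : ℝ, τ < T₁ → u τ = fun y => u (τ - P) (y - d) + w) ∨
  (∃ (T₁ K β : ℝ) (U : E3 → E3) (ξ η : ℝ → E3), T₁ ≤ 0 ∧ 0 ≤ K ∧ β * (1 - ρ) < 1 ∧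
    (∀ τ : ℝ, τ < T₁ → u τ = fun y => U (y - ξ τ) + η τ) ∧ (∀ τ : ℝ, τ < T₁ → ‖ξ τ‖ ≤ K * (1 + |τ|) ^ β)) ∨
  (∃ (T₁ : ℝ) (v : E3 → E3) (Q : ℝ → (E3 ≃ₗᵢ[ℝ] E3)), T₁ ≤ 0 ∧ ∀ τ : ℝ, τ < T₁ → u τ = fun x => Q τ (v ((Q τ).symm x))) ∨
  (∃ (T₁ P : ℝ) (L : E3 ≃ₗᵢ[ℝ] E3), T₁ ≤ 0 ∧ 0 < P ∧ ∀ τ : ℝ, τ < T₁ → u τ = fun x => L (u (τ - P) (L.symm x))) ∨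
  (∃ (T₁ : ℝ) (U : E3 → E3) (ξ η : ℝ → E3), T₁ ≤ 0 ∧ ContDiff ℝ 1 ξ ∧ ∀ τ : ℝ, τ < T₁ → u τ = fun y => U (y - ξ τ) + η τ) ∨
  (∃ (T T₁ : ℝ) (ξ η : ℝ → E3) (V : E3 → E3) (τ₁ τ₂ : ℝ), T₁ ≤ 0 ∧ T₁ ≤ T ∧ ContDiff ℝ 1 ξ ∧
    (∀ τ : ℝ, τ < T₁ → u τ = fun y => (T - τ) ^ (1 / (2 + ρ) - 1) • V ((T - τ) ^ (-(1 / (2 + ρ))) • (y - ξ τ)) + η τ) ∧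
    τ₁ < T₁ ∧ τ₂ < T₁ ∧ (T - τ₁) ^ (1 - 1 / (2 + ρ)) • deriv ξ τ₁ ≠ (T - τ₂) ^ (1 - 1 / (2 + ρ)) • deriv ξ τ₂) ∨
  (∃ (T₁ K β : ℝ) (U : E3 → E3) (R : ℝ → (E3 ≃ₗᵢ[ℝ] E3)) (ξ η : ℝ → E3), T₁ ≤ 0 ∧ 0 ≤ K ∧ β * (1 - ρ) < 1 ∧
    (∀ τ : ℝ, τ < T₁ → u τ = fun y => R τ (U ((R τ).symm (y - ξ τ))) + η τ) ∧ (∀ τ : ℝ, τ < T₁ → ‖ξ τ‖ ≤ K * (1 + |τ|) ^ β)) ∨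
  (∃ (T₁ : ℝ) (U : E3 → E3) (R : ℝ → (E3 ≃ₗᵢ[ℝ] E3)) (ξ η : ℝ → E3), T₁ ≤ 0 ∧ ContDiff ℝ 1 (fun τ => ((R τ : E3 ≃ₗᵢ[ℝ] E3) : E3 →L[ℝ] E3)) ∧ ContDiff ℝ 1 ξ ∧
    ∀ τ : ℝ, τ < T₁ → u τ = fun y => R τ (U ((R τ).symm (y - ξ τ))) + η τ) ∨
  (∃ (T₁ : ℝ) (U : E3 → E3) (A : ℝ → (E3 →L[ℝ] E3)) (ξ η : ℝ → E3), T₁ ≤ 0 ∧ ContDiff ℝ 1 A ∧ (∀ τ x, inner ℝ (A τ x) x = 0) ∧ ContDiff ℝ 1 ξ ∧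
    ∀ τ : ℝ, τ < T₁ → u τ = fun y => NormedSpace.exp (τ • A τ) (U (NormedSpace.exp (-(τ • A τ)) (y - ξ τ))) + η τ)

/-- WEAKLY TAME PAST (v29–v31): on some past sub-slab `(−∞, T₁)`, `T₁ ≤ 0`, EITHER the weak gradient `H` is a.e. symmetric (p597550), OR every slice is periodic in a
fixed direction / has screw-symmetric modulus (p598603), OR the member is time-periodic there (p599372), OR its energy is backward-tight, OR the past is a traveling wave
`u(τ,y) = U(y − τb)` (p600154). -/
@[reducible] def IsWeakTamePast (u : ℝ → E3 → E3) (H : ℝ → E3 → E3 →L[ℝ] E3) : Prop :=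
  (∃ T₁ : ℝ, T₁ ≤ 0 ∧ ∀ᵐ z ∂(volume.restrict (Set.Iio T₁ ×ˢ (Set.univ : Set E3))),
      ∀ v w : E3, inner ℝ (H z.1 z.2 v) w = inner ℝ (H z.1 z.2 w) v) ∨
    (∃ T₁ : ℝ, T₁ ≤ 0 ∧ ∃ v : E3, v ≠ 0 ∧ ∀ τ : ℝ, τ < T₁ → ∀ y : E3, u τ (y + v) = u τ y) ∨
    (∃ T₁ : ℝ, T₁ ≤ 0 ∧ ∃ (L : E3 ≃ₗᵢ[ℝ] E3) (y₀ w : E3), w ≠ 0 ∧ L w = w ∧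
      ∀ τ : ℝ, τ < T₁ → ∀ y : E3, ‖u τ (L (y - y₀) + y₀ + w)‖ = ‖u τ y‖) ∨
    (∃ T₁ : ℝ, T₁ ≤ 0 ∧ ∃ P : ℝ, 0 < P ∧ ∀ τ : ℝ, τ < T₁ → u (τ - P) = u τ) ∨
    (∀ ε : ℝ, 0 < ε → ∃ R : ℝ, 0 < R ∧ ∃ N : ℝ, ∀ᵐ s ∂(volume : Measure ℝ), s < -N →
      ∫⁻ x in (Metric.ball (0 : E3) R)ᶜ, ‖u s x‖ₑ ^ 2 ≤ ENNReal.ofReal ε) ∨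
    ∃ T₁ : ℝ, T₁ ≤ 0 ∧ ∃ (U : E3 → E3) (G₀ : E3 → E3 →L[ℝ] E3) (b : E3),
      (∀ τ : ℝ, τ < T₁ → u τ = fun y => U (y - τ • b)) ∧ (∀ τ : ℝ, τ < T₁ → H τ = fun y => G₀ (y - τ • b))

/-- `(u,p)` is EXACTLY SELF-SIMILAR with the class exponents and profile `(V,P)`:
`u(τ) = (−τ)^{γ−1} V((−τ)^{−γ}·)`, `p(τ) = (−τ)^{2(γ−1)} P((−τ)^{−γ}·)`, `γ = 1/(2+ρ)`, for `τ < 0`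
(the Literature ansatz `selfSimilarCollapse` / `selfSimilarCollapsePressure` with blow-up time `0`; the binder
shape of the lineage's member-level theorems, e.g. `selfSimilar_profile_local_energy_equality`). -/
@[reducible] def IsExactlySelfSimilar (ρ : ℝ) (u : ℝ → E3 → E3) (p : ℝ → E3 → ℝ) (V : E3 → E3) (P : E3 → ℝ) :
    Prop :=
  (∀ τ : ℝ, τ < 0 → u τ = Literature.Analysis.FluidPDE.selfSimilarCollapse (1 / (2 + ρ)) 0 V τ) ∧
    (∀ τ : ℝ, τ < 0 → p τ = Literature.Analysis.FluidPDE.selfSimilarCollapsePressure (1 / (2 + ρ)) 0 P τ)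

/-- The VELOCITY is an exact similarity clock about the space–time origin at SOME real rate `g` (NEW in v54) — senses/credits: CENSUS-19832-vNN.md. -/
@[reducible] def IsSelfSimilarVelocity (u : ℝ → E3 → E3) : Prop :=
  ∃ (g : ℝ) (W : E3 → E3), ∀ τ : ℝ, τ < 0 → u τ = Literature.Analysis.FluidPDE.selfSimilarCollapse g 0 W τ

/-- `C²` POWER-CLOCK COLLAPSE at an interior or final time (v62; CENTRE/EXPONENT TRANSFER `ClockTransfer.ae_eq_zero_of_originAnalysis`, ns-ezl-w6 g2): for some `T ≤ 0`, `x₀`,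
`ρ′ ∈ (0,1)` and a `C²` profile `W`, `u(τ,x) = (T−τ)^{g−1} W((T−τ)^{−g}(x − x₀))` for ALL `τ < T`, `g = 1/(2+ρ′)`; the transfer yields an origin-centred member of exponent `ρ′` — closed
INSIDE the composition (no filler of its own). -/
@[reducible] def IsCollapseClockC2 (u : ℝ → E3 → E3) : Prop :=
  ∃ (T : ℝ) (x₀ : E3) (ρ' : ℝ) (W : E3 → E3), T ≤ 0 ∧ 0 < ρ' ∧ ρ' < 1 ∧ ContDiff ℝ 2 W ∧
    ∀ τ : ℝ, τ < T → u τ = fun x => Literature.Analysis.FluidPDE.selfSimilarCollapse (1 / (2 + ρ')) T W τ (x - x₀)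

/-- The profile is EXTREMAL (gauge-saturating): the normalised energy `L^{2ρ−1}∫_{B_L}|V|²` is eventually
bounded below by a positive constant (Bochner form, the binder shape of `EnergySaturation.ae_eq_zero_of_subExtremal`;
for class members `V ∈ L²_loc`, so there is no junk value). -/
@[reducible] def IsExtremalProfile (ρ : ℝ) (V : E3 → E3) : Prop :=
  ∃ ε : ℝ, 0 < ε ∧ ∃ L₀ : ℝ, ∀ L : ℝ, L₀ ≤ L →
    ε ≤ L ^ (2 * ρ - 1) * ∫ y in Metric.ball (0 : E3) L, ‖V y‖ ^ 2

/-- The velocity profile is CRITICALLY HOMOGENEOUS (v14): `V (s • y) = s^{−(1+ρ)} • V y` for all `s > 0` — degree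
`1 − 1/γ` for `γ = 1/(2+ρ)`, the `|y|^{1−1/γ}` tail profiles of Chae–Shvydkoy / Shvydkoy; the binder shape of
`SteadyProfile.selfSimilar_ae_eq_zero_of_homogeneousProfile` (such a member is steady on the slab and dies by rung B). -/
@[reducible] def IsHomogeneousProfile (ρ : ℝ) (V : E3 → E3) : Prop :=
  ∀ s : ℝ, 0 < s → ∀ y : E3, V (s • y) = s ^ (-(1 + ρ)) • V y

/-- BERNOULLI PIERCING on spheres beyond every radius (v48, LEAD g11 `…SelfSimilarBernoulliPiercing`; ⊇ irrotational piercing ⊇ radial barrier ⊇ sub-drift ⊇ bounded ⊇ compact vorticity) — senses/credits: CENSUS-19832-vNN.md. -/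
@[reducible] def HasBernoulliPiercing (ρ : ℝ) (V : E3 → E3) : Prop :=
  ∀ P' : E3 → ℝ, Literature.Analysis.FluidPDE.IsSelfSimilarEulerProfile (1 / (2 + ρ)) 0 V P' →
    ∀ h R₀ : ℝ, ∃ R : ℝ, R₀ ≤ R ∧ ∀ y : E3, ‖y‖ = R →
      inner ℝ y (V y) ≤ -(1 / (2 + ρ) * ‖y‖ ^ 2) →
        (Literature.Analysis.FluidPDE.curl V y = 0 ∨
          Literature.Analysis.FluidPDE.selfSimilarBernoulli (1 / (2 + ρ)) 0 V P' y < h)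

/-- FAST VORTICAL BERNOULLI CHANNEL, twelve killed senses — senses/credits: CENSUS-19832-vNN.md. -/
@[reducible] def HasFastVorticalChannel (ρ : ℝ) (V : E3 → E3) : Prop :=
  (∃ c₁ : ℝ, 0 < c₁ ∧
    ∀ P' : E3 → ℝ, Literature.Analysis.FluidPDE.IsSelfSimilarEulerProfile (1 / (2 + ρ)) 0 V P' →
      ∀ h : ℝ, ∃ R₀ : ℝ, ∀ y : E3, R₀ ≤ ‖y‖ → h < Literature.Analysis.FluidPDE.selfSimilarBernoulli (1 / (2 + ρ)) 0 V P' y →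
        Literature.Analysis.FluidPDE.curl V y ≠ 0 →
          inner ℝ y (Literature.Analysis.FluidPDE.selfSimilarTransport (1 / (2 + ρ)) 0 V y) ≤ -(c₁ * ‖y‖ ^ 2)) ∨
  (∃ c₁ μ : ℝ, 0 < c₁ ∧ 0 < μ ∧
    ∀ P' : E3 → ℝ, Literature.Analysis.FluidPDE.IsSelfSimilarEulerProfile (1 / (2 + ρ)) 0 V P' →
      ∀ h : ℝ, ∃ R₀ : ℝ, ∀ y : E3, R₀ ≤ ‖y‖ → h < Literature.Analysis.FluidPDE.selfSimilarBernoulli (1 / (2 + ρ)) 0 V P' y →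
        Literature.Analysis.FluidPDE.curl V y ≠ 0 →
          -(c₁ * ‖y‖ ^ 2) ≤ inner ℝ y (Literature.Analysis.FluidPDE.selfSimilarTransport (1 / (2 + ρ)) 0 V y) →
          inner ℝ y (Literature.Analysis.FluidPDE.selfSimilarTransport (1 / (2 + ρ)) 0 V y) ≤ 0 →
          (2 * c₁ ^ 2 + μ) * ‖y‖ ^ 2 ≤ ‖Literature.Analysis.FluidPDE.selfSimilarTransport (1 / (2 + ρ)) 0 V y‖ ^ 2 +
            (1 / (2 + ρ)) * inner ℝ y (Literature.Analysis.FluidPDE.selfSimilarTransport (1 / (2 + ρ)) 0 V y) +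
            inner ℝ y (fderiv ℝ V y (Literature.Analysis.FluidPDE.selfSimilarTransport (1 / (2 + ρ)) 0 V y))) ∨
  (∃ c₁ μ : ℝ, 0 < c₁ ∧ 0 < μ ∧
    ∀ P' : E3 → ℝ, Literature.Analysis.FluidPDE.IsSelfSimilarEulerProfile (1 / (2 + ρ)) 0 V P' →
      ∀ h : ℝ, ∃ R₀ : ℝ, ∀ y : E3, R₀ ≤ ‖y‖ → h < Literature.Analysis.FluidPDE.selfSimilarBernoulli (1 / (2 + ρ)) 0 V P' y →
        Literature.Analysis.FluidPDE.curl V y ≠ 0 →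
          -(c₁ * ‖y‖ ^ 2) ≤ inner ℝ y (Literature.Analysis.FluidPDE.selfSimilarTransport (1 / (2 + ρ)) 0 V y) →
          inner ℝ y (Literature.Analysis.FluidPDE.selfSimilarTransport (1 / (2 + ρ)) 0 V y) ≤ 0 →
          2 * P' y + inner ℝ y (gradient P' y) ≤ 2 * h + (2 * (1 / (2 + ρ)) * (1 - 1 / (2 + ρ)) - 2 * c₁ ^ 2 - μ) * ‖y‖ ^ 2) ∨
  (∃ κb a₀ : ℝ, 0 < κb ∧ 0 < a₀ ∧
    ∀ P' : E3 → ℝ, Literature.Analysis.FluidPDE.IsSelfSimilarEulerProfile (1 / (2 + ρ)) 0 V P' →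
      ∀ h : ℝ, ∃ R₀ : ℝ, ∀ y : E3, R₀ ≤ ‖y‖ → h < Literature.Analysis.FluidPDE.selfSimilarBernoulli (1 / (2 + ρ)) 0 V P' y →
        Literature.Analysis.FluidPDE.curl V y ≠ 0 →
          -κb ≤ inner ℝ y (Literature.Analysis.FluidPDE.selfSimilarTransport (1 / (2 + ρ)) 0 V y) →
          inner ℝ y (Literature.Analysis.FluidPDE.selfSimilarTransport (1 / (2 + ρ)) 0 V y) ≤ 0 →
          a₀ ≤ ‖Literature.Analysis.FluidPDE.selfSimilarTransport (1 / (2 + ρ)) 0 V y‖ ^ 2 +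
            (1 / (2 + ρ)) * inner ℝ y (Literature.Analysis.FluidPDE.selfSimilarTransport (1 / (2 + ρ)) 0 V y) +
            inner ℝ y (fderiv ℝ V y (Literature.Analysis.FluidPDE.selfSimilarTransport (1 / (2 + ρ)) 0 V y))) ∨
  (∃ c₁ μ : ℝ, 0 < c₁ ∧ 0 < μ ∧
    ∀ P' : E3 → ℝ, Literature.Analysis.FluidPDE.IsSelfSimilarEulerProfile (1 / (2 + ρ)) 0 V P' →
      ∀ h : ℝ, ∃ R₀ : ℝ, ∀ y : E3, R₀ ≤ ‖y‖ → h < Literature.Analysis.FluidPDE.selfSimilarBernoulli (1 / (2 + ρ)) 0 V P' y →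
        Literature.Analysis.FluidPDE.curl V y ≠ 0 →
          -(c₁ * ‖y‖ ^ 2) ≤ inner ℝ y (Literature.Analysis.FluidPDE.selfSimilarTransport (1 / (2 + ρ)) 0 V y) →
          inner ℝ y (Literature.Analysis.FluidPDE.selfSimilarTransport (1 / (2 + ρ)) 0 V y) ≤ 0 →
          inner ℝ y (gradient P' y) ≤ ‖Literature.Analysis.FluidPDE.selfSimilarTransport (1 / (2 + ρ)) 0 V y‖ ^ 2 +
            ((1 / (2 + ρ)) * (1 - 1 / (2 + ρ)) - 2 * c₁ ^ 2 - μ) * ‖y‖ ^ 2) ∨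
  (∃ κb a₀ : ℝ, 0 < κb ∧ 0 < a₀ ∧
    ∀ P' : E3 → ℝ, Literature.Analysis.FluidPDE.IsSelfSimilarEulerProfile (1 / (2 + ρ)) 0 V P' →
      ∀ h : ℝ, ∃ R₀ : ℝ, ∀ y : E3, R₀ ≤ ‖y‖ → h < Literature.Analysis.FluidPDE.selfSimilarBernoulli (1 / (2 + ρ)) 0 V P' y →
        Literature.Analysis.FluidPDE.curl V y ≠ 0 →
          -κb ≤ inner ℝ y (Literature.Analysis.FluidPDE.selfSimilarTransport (1 / (2 + ρ)) 0 V y) →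
          inner ℝ y (Literature.Analysis.FluidPDE.selfSimilarTransport (1 / (2 + ρ)) 0 V y) ≤ 0 →
          2 * P' y + inner ℝ y (gradient P' y) ≤ 2 * h + 2 * (1 / (2 + ρ)) * (1 - 1 / (2 + ρ)) * ‖y‖ ^ 2 - a₀) ∨
  (∃ κb a₀ : ℝ, 0 < κb ∧ 0 < a₀ ∧
    ∀ P' : E3 → ℝ, Literature.Analysis.FluidPDE.IsSelfSimilarEulerProfile (1 / (2 + ρ)) 0 V P' →
      ∀ h : ℝ, ∃ R₀ : ℝ, ∀ y : E3, R₀ ≤ ‖y‖ → h < Literature.Analysis.FluidPDE.selfSimilarBernoulli (1 / (2 + ρ)) 0 V P' y →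
        Literature.Analysis.FluidPDE.curl V y ≠ 0 →
          -κb ≤ inner ℝ y (Literature.Analysis.FluidPDE.selfSimilarTransport (1 / (2 + ρ)) 0 V y) →
          inner ℝ y (Literature.Analysis.FluidPDE.selfSimilarTransport (1 / (2 + ρ)) 0 V y) ≤ 0 →
          a₀ / ‖y‖ ^ 2 ≤ ‖Literature.Analysis.FluidPDE.selfSimilarTransport (1 / (2 + ρ)) 0 V y‖ ^ 2 +
            (1 / (2 + ρ)) * inner ℝ y (Literature.Analysis.FluidPDE.selfSimilarTransport (1 / (2 + ρ)) 0 V y) +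
            inner ℝ y (fderiv ℝ V y (Literature.Analysis.FluidPDE.selfSimilarTransport (1 / (2 + ρ)) 0 V y))) ∨
  (∃ κb a₀ : ℝ, 0 < κb ∧ 0 < a₀ ∧
    ∀ P' : E3 → ℝ, Literature.Analysis.FluidPDE.IsSelfSimilarEulerProfile (1 / (2 + ρ)) 0 V P' →
      ∀ h : ℝ, ∃ R₀ : ℝ, ∀ y : E3, R₀ ≤ ‖y‖ → h < Literature.Analysis.FluidPDE.selfSimilarBernoulli (1 / (2 + ρ)) 0 V P' y →
        Literature.Analysis.FluidPDE.curl V y ≠ 0 →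
          -κb ≤ inner ℝ y (Literature.Analysis.FluidPDE.selfSimilarTransport (1 / (2 + ρ)) 0 V y) → inner ℝ y (Literature.Analysis.FluidPDE.selfSimilarTransport (1 / (2 + ρ)) 0 V y) ≤ 0 →
          inner ℝ y (gradient P' y) ≤ ‖Literature.Analysis.FluidPDE.selfSimilarTransport (1 / (2 + ρ)) 0 V y‖ ^ 2 +
            (1 / (2 + ρ)) * (1 - 1 / (2 + ρ)) * ‖y‖ ^ 2 - a₀) ∨
  (∃ κb a₀ e₁ e₂ : ℝ, 0 < κb ∧ 0 < a₀ ∧ 0 ≤ e₁ ∧ e₁ < ρ ∧ 0 ≤ e₂ ∧ e₂ < 2 + ρ + e₁ ∧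
    ∀ P' : E3 → ℝ, Literature.Analysis.FluidPDE.IsSelfSimilarEulerProfile (1 / (2 + ρ)) 0 V P' →
      ∀ h : ℝ, ∃ R₀ : ℝ, ∀ y : E3, R₀ ≤ ‖y‖ → h < Literature.Analysis.FluidPDE.selfSimilarBernoulli (1 / (2 + ρ)) 0 V P' y →
        Literature.Analysis.FluidPDE.curl V y ≠ 0 →
          -(κb * ‖y‖ ^ (-e₁)) ≤ inner ℝ y (Literature.Analysis.FluidPDE.selfSimilarTransport (1 / (2 + ρ)) 0 V y) → inner ℝ y (Literature.Analysis.FluidPDE.selfSimilarTransport (1 / (2 + ρ)) 0 V y) ≤ 0 →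
          a₀ * ‖y‖ ^ (-e₂) ≤ ‖Literature.Analysis.FluidPDE.selfSimilarTransport (1 / (2 + ρ)) 0 V y‖ ^ 2 +
            (1 / (2 + ρ)) * inner ℝ y (Literature.Analysis.FluidPDE.selfSimilarTransport (1 / (2 + ρ)) 0 V y) +
            inner ℝ y (fderiv ℝ V y (Literature.Analysis.FluidPDE.selfSimilarTransport (1 / (2 + ρ)) 0 V y))) ∨
  (∀ P' : E3 → ℝ, Literature.Analysis.FluidPDE.IsSelfSimilarEulerProfile (1 / (2 + ρ)) 0 V P' →
      ∃ O : Set E3, IsOpen O ∧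
        (∀ (Z : ℝ → E3) (t : ℝ), 0 ≤ t →
          (∀ s ∈ Set.Icc 0 t, HasDerivAt Z (-(Literature.Analysis.FluidPDE.selfSimilarTransport (1 / (2 + ρ)) 0 V (Z s))) s) → Z 0 ∈ O → Z t ∈ O) ∧
        (∃ x₁ ∈ O, Literature.Analysis.FluidPDE.curl V x₁ ≠ 0) ∧
        ∃ κb a₀ e₁ e₂ Rf : ℝ, 0 < κb ∧ 0 < a₀ ∧ 0 ≤ e₁ ∧ e₁ < ρ ∧ 0 ≤ e₂ ∧ e₂ < 2 + ρ + e₁ ∧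
          ∀ y ∈ O, Rf ≤ ‖y‖ → Literature.Analysis.FluidPDE.curl V y ≠ 0 →
            -(κb * ‖y‖ ^ (-e₁)) ≤ inner ℝ y (Literature.Analysis.FluidPDE.selfSimilarTransport (1 / (2 + ρ)) 0 V y) → inner ℝ y (Literature.Analysis.FluidPDE.selfSimilarTransport (1 / (2 + ρ)) 0 V y) ≤ 0 →
            a₀ * ‖y‖ ^ (-e₂) ≤ ‖Literature.Analysis.FluidPDE.selfSimilarTransport (1 / (2 + ρ)) 0 V y‖ ^ 2 +
              (1 / (2 + ρ)) * inner ℝ y (Literature.Analysis.FluidPDE.selfSimilarTransport (1 / (2 + ρ)) 0 V y) +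
              inner ℝ y (fderiv ℝ V y (Literature.Analysis.FluidPDE.selfSimilarTransport (1 / (2 + ρ)) 0 V y))) ∨
  (∃ κb a₀ e₁ e₂ : ℝ, 0 < κb ∧ 0 < a₀ ∧ 0 ≤ e₁ ∧ e₁ < ρ ∧ 0 ≤ e₂ ∧ e₂ < 2 + ρ + e₁ ∧
    ∀ P' : E3 → ℝ, Literature.Analysis.FluidPDE.IsSelfSimilarEulerProfile (1 / (2 + ρ)) 0 V P' →
      ∃ x₁ : E3, Literature.Analysis.FluidPDE.curl V x₁ ≠ 0 ∧ ∃ h : ℝ, h < Literature.Analysis.FluidPDE.selfSimilarBernoulli (1 / (2 + ρ)) 0 V P' x₁ ∧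
        ∃ R₀ : ℝ, ∀ y : E3, R₀ ≤ ‖y‖ → h < Literature.Analysis.FluidPDE.selfSimilarBernoulli (1 / (2 + ρ)) 0 V P' y →
          Literature.Analysis.FluidPDE.curl V y ≠ 0 →
            -(κb * ‖y‖ ^ (-e₁)) ≤ inner ℝ y (Literature.Analysis.FluidPDE.selfSimilarTransport (1 / (2 + ρ)) 0 V y) → inner ℝ y (Literature.Analysis.FluidPDE.selfSimilarTransport (1 / (2 + ρ)) 0 V y) ≤ 0 →
            a₀ * ‖y‖ ^ (-e₂) ≤ ‖Literature.Analysis.FluidPDE.selfSimilarTransport (1 / (2 + ρ)) 0 V y‖ ^ 2 +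
              (1 / (2 + ρ)) * inner ℝ y (Literature.Analysis.FluidPDE.selfSimilarTransport (1 / (2 + ρ)) 0 V y) +
              inner ℝ y (fderiv ℝ V y (Literature.Analysis.FluidPDE.selfSimilarTransport (1 / (2 + ρ)) 0 V y))) ∨
  (∀ P' : E3 → ℝ, Literature.Analysis.FluidPDE.IsSelfSimilarEulerProfile (1 / (2 + ρ)) 0 V P' →
      ∃ O : Set E3, IsOpen O ∧
        (∀ (Z : ℝ → E3) (t : ℝ), 0 ≤ t →
          (∀ s ∈ Set.Icc 0 t, HasDerivAt Z (-(Literature.Analysis.FluidPDE.selfSimilarTransport (1 / (2 + ρ)) 0 V (Z s))) s) → Z 0 ∈ O → Z t ∈ O) ∧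
        (∃ x₁ ∈ O, Literature.Analysis.FluidPDE.curl V x₁ ≠ 0) ∧
        ∃ E : Set E3,
          (∀ᵐ y ∂(volume : Measure E3), y ∈ O →
            ∀ (Z : ℝ → E3) (t : ℝ), 0 ≤ t →
              (∀ s ∈ Set.Icc 0 t, HasDerivAt Z (-(Literature.Analysis.FluidPDE.selfSimilarTransport (1 / (2 + ρ)) 0 V (Z s))) s) → Z 0 = y →
                ∀ s ∈ Set.Icc 0 t, Z s ∉ E) ∧
        ∃ κb a₀ e₁ e₂ Rf : ℝ, 0 < κb ∧ 0 < a₀ ∧ 0 ≤ e₁ ∧ e₁ < ρ ∧ 0 ≤ e₂ ∧ e₂ < 2 + ρ + e₁ ∧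
          ∀ y ∈ O, y ∉ E → Rf ≤ ‖y‖ → Literature.Analysis.FluidPDE.curl V y ≠ 0 →
            -(κb * ‖y‖ ^ (-e₁)) ≤ inner ℝ y (Literature.Analysis.FluidPDE.selfSimilarTransport (1 / (2 + ρ)) 0 V y) → inner ℝ y (Literature.Analysis.FluidPDE.selfSimilarTransport (1 / (2 + ρ)) 0 V y) ≤ 0 →
            a₀ * ‖y‖ ^ (-e₂) ≤ ‖Literature.Analysis.FluidPDE.selfSimilarTransport (1 / (2 + ρ)) 0 V y‖ ^ 2 +
              (1 / (2 + ρ)) * inner ℝ y (Literature.Analysis.FluidPDE.selfSimilarTransport (1 / (2 + ρ)) 0 V y) +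
              inner ℝ y (fderiv ℝ V y (Literature.Analysis.FluidPDE.selfSimilarTransport (1 / (2 + ρ)) 0 V y)))

/-- RESIDENCE CLOCK, nine killed senses — senses/credits: CENSUS-19832-vNN.md. -/
@[reducible] def HasResidenceClock (ρ : ℝ) (V : E3 → E3) : Prop :=
  (∃ s₁ : ℝ, 0 ≤ s₁ ∧ ∀ x₀ : E3, Literature.Analysis.FluidPDE.curl V x₀ ≠ 0 → ∃ r : ℝ, 0 < r ∧ ∃ R₀ : ℝ, ∀ R : ℝ, R₀ ≤ R →
      ∀ (V' : E3 → E3) (K Rbig : ℝ), ContDiff ℝ 2 V' → (∀ y, ‖fderiv ℝ V' y‖ ≤ K) → 2 * R < Rbig →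
        (∀ w ∈ Metric.ball (0 : E3) Rbig, V' w = V w) →
        (volume (Metric.ball x₀ r ∩ {y | ∀ σ ∈ Set.Icc 0 (s₁ * Real.log R),
          ‖Literature.Analysis.ODE.evolutionMap (fun _ : ℝ => Literature.Analysis.FluidPDE.selfSimilarTransport (1 / (2 + ρ)) 0 V') 0 (-σ) y‖ ≤ 2 * R})).toReal ≤
          (volume (Metric.ball x₀ r)).toReal / 2) ∨
  (∀ c' : ℝ, 0 < c' → ∀ x₀ : E3, Literature.Analysis.FluidPDE.curl V x₀ ≠ 0 → ∃ r : ℝ, 0 < r ∧ ∃ R₀ : ℝ, ∀ R : ℝ, R₀ ≤ R →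
      ∀ (V' : E3 → E3) (K Rbig : ℝ), ContDiff ℝ 2 V' → (∀ y, ‖fderiv ℝ V' y‖ ≤ K) → 2 * R < Rbig →
        (∀ w ∈ Metric.ball (0 : E3) Rbig, V' w = V w) →
        (volume (Metric.ball x₀ r ∩ {y | ∀ σ ∈ Set.Icc 0 (c' * R ^ (2 + ρ)),
          ‖Literature.Analysis.ODE.evolutionMap (fun _ : ℝ => Literature.Analysis.FluidPDE.selfSimilarTransport (1 / (2 + ρ)) 0 V') 0 (-σ) y‖ ≤ 2 * R})).toReal ≤
          (volume (Metric.ball x₀ r)).toReal / 2) ∨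
  (∃ s : ℝ, s < 1 ∧ (∀ z v : E3, inner ℝ (fderiv ℝ V z v) v ≤ s * ‖v‖ ^ 2) ∧
    ∀ ε : ℝ, 0 < ε → ∃ R₂ : ℝ, ∀ z : E3, R₂ ≤ ‖z‖ → Real.log ‖Literature.Analysis.FluidPDE.curl V z‖ ≤ ε * ‖z‖ ^ (2 + ρ)) ∨
  (∃ s : ℝ, s < (1 + 2 * ρ) / (2 * (2 + ρ)) ∧ ∀ z v : E3, inner ℝ (fderiv ℝ V z v) v ≤ s * ‖v‖ ^ 2) ∨
  (∃ θ : ℝ, θ < 2 + ρ ∧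
    (∀ P' : E3 → ℝ, Literature.Analysis.FluidPDE.IsSelfSimilarEulerProfile (1 / (2 + ρ)) 0 V P' →
      ∃ C : ℝ, ∀ r : ℝ, 1 ≤ r → ∀ y y' : E3, ‖y‖ ≤ r → ‖y'‖ ≤ r →
        Literature.Analysis.FluidPDE.selfSimilarBernoulli (1 / (2 + ρ)) 0 V P' y - Literature.Analysis.FluidPDE.selfSimilarBernoulli (1 / (2 + ρ)) 0 V P' y' ≤ C * r ^ θ) ∧
    ∀ c' : ℝ, 0 < c' → ∀ x₀ : E3, Literature.Analysis.FluidPDE.curl V x₀ ≠ 0 → ∃ r : ℝ, 0 < r ∧ ∃ R₀ : ℝ,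
      ∀ R : ℝ, R₀ ≤ R → ∀ (V' : E3 → E3) (K Rbig : ℝ), ContDiff ℝ 2 V' →
        (∀ y, ‖fderiv ℝ V' y‖ ≤ K) → 2 * R < Rbig → (∀ w ∈ Metric.ball (0 : E3) Rbig, V' w = V w) →
        (volume (Metric.ball x₀ r ∩ {a | ∀ σ ∈ Set.Icc 0 (c' * R ^ (2 + ρ)), ‖Literature.Analysis.ODE.evolutionMap (fun _ : ℝ => Literature.Analysis.FluidPDE.selfSimilarTransport (1 / (2 + ρ)) 0 V') 0 (-σ) a‖ ≤ 2 * R} ∩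
          {a | c' * R ^ (2 + ρ) / 2 ≤ (volume {σ ∈ Set.Icc 0 (c' * R ^ (2 + ρ)) |
            ‖Literature.Analysis.FluidPDE.selfSimilarTransport (1 / (2 + ρ)) 0 V' (Literature.Analysis.ODE.evolutionMap (fun _ : ℝ => Literature.Analysis.FluidPDE.selfSimilarTransport (1 / (2 + ρ)) 0 V') 0 (-σ) a)‖ < R ^ (-((2 + ρ - θ) / 4))}).toReal})).toReal ≤
          (volume (Metric.ball x₀ r)).toReal / 4) ∨
  (∀ c' : ℝ, 0 < c' → ∃ x₀ : E3, ∃ r : ℝ, 0 < r ∧ ∃ R₀ : ℝ, ∀ R : ℝ, R₀ ≤ R →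
      ∀ (V' : E3 → E3) (K Rbig : ℝ), ContDiff ℝ 2 V' → (∀ y, ‖fderiv ℝ V' y‖ ≤ K) → 2 * R < Rbig →
        (∀ w ∈ Metric.ball (0 : E3) Rbig, V' w = V w) →
        (volume (Metric.ball x₀ r ∩ {y | ∀ σ ∈ Set.Icc 0 (c' * R ^ (2 + ρ)),
          ‖Literature.Analysis.ODE.evolutionMap (fun _ : ℝ => Literature.Analysis.FluidPDE.selfSimilarTransport (1 / (2 + ρ)) 0 V') 0 (-σ) y‖ ≤ 2 * R})).toReal ≤
          (volume (Metric.ball x₀ r)).toReal / 2) ∨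
  (∃ θ : ℝ, θ < 2 + ρ ∧
    (∀ P' : E3 → ℝ, Literature.Analysis.FluidPDE.IsSelfSimilarEulerProfile (1 / (2 + ρ)) 0 V P' →
      ∃ C : ℝ, ∀ r : ℝ, 1 ≤ r → ∀ y y' : E3, ‖y‖ ≤ r → ‖y'‖ ≤ r →
        Literature.Analysis.FluidPDE.selfSimilarBernoulli (1 / (2 + ρ)) 0 V P' y - Literature.Analysis.FluidPDE.selfSimilarBernoulli (1 / (2 + ρ)) 0 V P' y' ≤ C * r ^ θ) ∧
    ∀ c' : ℝ, 0 < c' → ∃ x₀ : E3, ∃ r : ℝ, 0 < r ∧ ∃ R₀ : ℝ,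
      ∀ R : ℝ, R₀ ≤ R → ∀ (V' : E3 → E3) (K Rbig : ℝ), ContDiff ℝ 2 V' →
        (∀ y, ‖fderiv ℝ V' y‖ ≤ K) → 2 * R < Rbig → (∀ w ∈ Metric.ball (0 : E3) Rbig, V' w = V w) →
        (volume (Metric.ball x₀ r ∩ {a | ∀ σ ∈ Set.Icc 0 (c' * R ^ (2 + ρ)), ‖Literature.Analysis.ODE.evolutionMap (fun _ : ℝ => Literature.Analysis.FluidPDE.selfSimilarTransport (1 / (2 + ρ)) 0 V') 0 (-σ) a‖ ≤ 2 * R} ∩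
          {a | c' * R ^ (2 + ρ) / 2 ≤ (volume {σ ∈ Set.Icc 0 (c' * R ^ (2 + ρ)) |
            ‖Literature.Analysis.FluidPDE.selfSimilarTransport (1 / (2 + ρ)) 0 V' (Literature.Analysis.ODE.evolutionMap (fun _ : ℝ => Literature.Analysis.FluidPDE.selfSimilarTransport (1 / (2 + ρ)) 0 V') 0 (-σ) a)‖ < R ^ (-((2 + ρ - θ) / 4))}).toReal})).toReal ≤
          (volume (Metric.ball x₀ r)).toReal / 4) ∨
  (∀ P' : E3 → ℝ, Literature.Analysis.FluidPDE.IsSelfSimilarEulerProfile (1 / (2 + ρ)) 0 V P' →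
      ∃ x₁ : E3, Literature.Analysis.FluidPDE.curl V x₁ ≠ 0 ∧ ∃ h : ℝ, h < Literature.Analysis.FluidPDE.selfSimilarBernoulli (1 / (2 + ρ)) 0 V P' x₁ ∧
        (∃ R₀ : ℝ, ∀ y : E3, R₀ ≤ ‖y‖ → h < Literature.Analysis.FluidPDE.selfSimilarBernoulli (1 / (2 + ρ)) 0 V P' y → Literature.Analysis.FluidPDE.curl V y ≠ 0 →
          inner ℝ y (Literature.Analysis.FluidPDE.selfSimilarTransport (1 / (2 + ρ)) 0 V y) = 0 →
          0 < ‖Literature.Analysis.FluidPDE.selfSimilarTransport (1 / (2 + ρ)) 0 V y‖ ^ 2 + (1 / (2 + ρ)) * inner ℝ y (Literature.Analysis.FluidPDE.selfSimilarTransport (1 / (2 + ρ)) 0 V y) +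
            inner ℝ y (fderiv ℝ V y (Literature.Analysis.FluidPDE.selfSimilarTransport (1 / (2 + ρ)) 0 V y))) ∧
        (∃ w₀ : ℝ, 0 < w₀ ∧ ∃ R₀ : ℝ, ∀ y : E3, R₀ ≤ ‖y‖ → h < Literature.Analysis.FluidPDE.selfSimilarBernoulli (1 / (2 + ρ)) 0 V P' y → Literature.Analysis.FluidPDE.curl V y ≠ 0 →
          inner ℝ y (Literature.Analysis.FluidPDE.selfSimilarTransport (1 / (2 + ρ)) 0 V y) ≤ 0 → w₀ ≤ ‖Literature.Analysis.FluidPDE.selfSimilarTransport (1 / (2 + ρ)) 0 V y‖) ∧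
        (∃ C θ R₀ : ℝ, θ < 2 + ρ ∧ ∀ (r : ℝ) (y y' : E3), R₀ ≤ ‖y‖ → ‖y‖ ≤ r → R₀ ≤ ‖y'‖ → ‖y'‖ ≤ r →
          h < Literature.Analysis.FluidPDE.selfSimilarBernoulli (1 / (2 + ρ)) 0 V P' y → Literature.Analysis.FluidPDE.curl V y ≠ 0 → h < Literature.Analysis.FluidPDE.selfSimilarBernoulli (1 / (2 + ρ)) 0 V P' y' → Literature.Analysis.FluidPDE.curl V y' ≠ 0 →
          Literature.Analysis.FluidPDE.selfSimilarBernoulli (1 / (2 + ρ)) 0 V P' y - Literature.Analysis.FluidPDE.selfSimilarBernoulli (1 / (2 + ρ)) 0 V P' y' ≤ C * r ^ θ)) ∨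
  (∀ P' : E3 → ℝ, Literature.Analysis.FluidPDE.IsSelfSimilarEulerProfile (1 / (2 + ρ)) 0 V P' →
      ∃ x₀ : E3, Literature.Analysis.FluidPDE.curl V x₀ ≠ 0 ∧ ∃ h : ℝ, h < Literature.Analysis.FluidPDE.selfSimilarBernoulli (1 / (2 + ρ)) 0 V P' x₀ ∧
        (∃ w₀ R₁ : ℝ, 0 < w₀ ∧ ∀ y : E3, R₁ ≤ ‖y‖ →
          h < Literature.Analysis.FluidPDE.selfSimilarBernoulli (1 / (2 + ρ)) 0 V P' y → Literature.Analysis.FluidPDE.curl V y ≠ 0 →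
            w₀ ≤ ‖Literature.Analysis.FluidPDE.selfSimilarTransport (1 / (2 + ρ)) 0 V y‖) ∧
        ∃ C θ : ℝ, θ < 2 + ρ ∧ ∀ R : ℝ, 1 ≤ R → ∀ z : E3, ‖z‖ ≤ 2 * R → Literature.Analysis.FluidPDE.curl V z ≠ 0 →
          h < Literature.Analysis.FluidPDE.selfSimilarBernoulli (1 / (2 + ρ)) 0 V P' z →
            Literature.Analysis.FluidPDE.selfSimilarBernoulli (1 / (2 + ρ)) 0 V P' z ≤ h + C * R ^ θ)

end Summit.NavierStokesRegularity.NavierStokesRegularity.Theorems.PowerGaugeEulerLiouville.Birth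

end
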